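import Summits.KontsevichZagierPeriods.KontsevichZagierPeriods.Theses.FurushoPentagon
import Summits.KontsevichZagierPeriods.KontsevichZagierPeriods.Theorems.StuffleInKZ.Negative.Core
import Summits.KontsevichZagierPeriods.KontsevichZagierPeriods.Theorems.FurushoPentagonStuffleInKZDefs
import Summits.KontsevichZagierPeriods.KontsevichZagierPeriods.Theorems.FurushoPentagonStuffleInKZPathsCombinatorics
import Summits.KontsevichZagierPeriods.KontsevichZagierPeriods.Theorems.FurushoPentagonStuffleInKZKernelStuffle
import Summits.KontsevichZagierPeriods.KontsevichZagierPeriods.Theorems.FurushoPentagonStuffleInKZCubeChart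
import Summits.KontsevichZagierPeriods.KontsevichZagierPeriods.Theorems.FurushoPentagonStuffleInKZTermTransport
import Literature.NumberTheory.Transcendental.KZProductIdeal
import Literature.NumberTheory.Transcendental.KZLogCalculusProofs
import Literature.NumberTheory.Transcendental.SemialgebraicMapsProofs

/-!
# `StuffleInKZ` (stmt-KontsevichZagierPeriods-3931, route `FurushoPentagon`) — line
`cumulative-cube-lattice-paths`: the composition (crux PROVED)

The crux: for every assignment `Z` pinned to Kontsevich's simplex classes `[Δ_u] = KZ.of (KZ.mzvRep u …)`
on admissible indices and all admissible `s`, `t`, the stuffle defect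
`Z s * Z t − Σ_{u ∈ s ∗ t} Z u` (Hoffman's harmonic product `MZV.stuffle`, with multiplicity) lies in
`KZ.relations`.

LINE (idea card `Cruxes/StuffleInKZ/Ideas/cumulative-cube-lattice-paths.md` ≈ `torus-kernel-subdivision`;
Soudères 2010 §1.3, Markarian 2020 Prop. 2). With `a = weight s`, `b = weight t`:
1. CHART (rule 2, one move per index; `stub_chartCalculus` + `stub_cubeChart`): `[Δ_u] ∼ [(0,1)^{|u|}, cubeKernel u]`
   along `tᵢ = x₀⋯xᵢ` (lower-triangular Jacobian `∏ᵢ∏_{j<i} x_j > 0`, image the open ordered simplex,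
   integrability transported along the chart).
2. PRODUCT (tree, `KZ.Equivalent.prod`): `[Δ_s]·[Δ_t] ∼ [(0,1)^{a+b}, cubeKernel s (x) · cubeKernel t (y)]`.
3. KERNEL IDENTITY (pure algebra on the cube; `stub_pathsCombinatorics` + `stub_kernelStuffle`):
   `cubeKernel s xs · cubeKernel t ys = Σ_{p ∈ paths |s| |t|} pathKernel s t p xs ys`, proved by the
   LAST-STEP recursion of the lattice paths and `(1−A)(1−B) + A(1−B) + B(1−A) = 1 − AB`.
4. FINITE ADDITIVITY (rule 1b, `|s∗t| − 1` moves; glue lemma `of_sub_list_sum_mem_relations`).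
5. TRANSPORT (rule 2, one coordinate permutation per path; `stub_termTransport`): the path kernel is the
   cube kernel of the merged index `merge p s t` at block-interleaved coordinates.
6. ENUMERATION (`stub_enumeration`): `MZV.stuffle s t = (paths |s| |t|).map (merge · s t)` as ORDERED lists.
The degenerate instances `s = []` / `t = []` are the unit law (tree: `Negative.stuffleInKZ_iff_ne_nil`).
No Newton–Leibniz move, no unproved fact, every intermediate a positive rational integral on an open cube.

This file: the sorry-free COMPOSITION `StuffleInKZ_of : StuffleInKZ` of the six stubs of the line, all
LANDED as sibling files and imported — objects + `stub_enumeration` (`…StuffleInKZDefs.lean`, p74377),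
`stub_chartCalculus` + `stub_cubeChart` (`…CubeChart.lean`, p75182, lead), `stub_pathsCombinatorics`
(`…PathsCombinatorics.lean`, p74757), `stub_kernelStuffle` (`…KernelStuffle.lean`, p74955),
`stub_termTransport` (`…TermTransport.lean`, p75353) — plus the glue (finite integrand additivity over a
list, the product domain of two cubes, non-emptiness of stuffle terms). Skeleton history:
`Cruxes/StuffleInKZ/Lines/cumulative-cube-lattice-paths.lean`.
-/

noncomputable section

open Set MeasureTheory
open Literature.NumberTheory.Transcendental
open Literature.NumberTheory.Transcendental.KZ
open Literature.NumberTheory.Transcendental.MZV (IsAdmissible stuffle weight isAdmissible_of_mem_stuffle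
  sum_of_mem_stuffle)
open Summit.KontsevichZagierPeriods.KontsevichZagierPeriods.Theses.FurushoPentagon (StuffleInKZ)

namespace Summit.KontsevichZagierPeriods.FurushoPentagon.StuffleInKZ

/-! ## Stubs of the line (registered on stmt-KontsevichZagierPeriods-3931) — all landed, imported -/

-- STUBS `stub_chartCalculus`, `stub_cubeChart` (the lead's) LANDED: `Theorems/FurushoPentagonStuffleInKZCubeChart.lean`
-- (p75182, imported; via the monomial-chart toolkit of the sibling line HoffmanRelationInKZ).

-- STUB `stub_enumeration` (MZV.stuffle s t = (paths |s| |t|).map (merge · s t)) LANDED with the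
-- objects of the line: `Theorems/FurushoPentagonStuffleInKZDefs.lean` (imported).

-- STUB `stub_pathsCombinatorics` LANDED: `Theorems/FurushoPentagonStuffleInKZPathsCombinatorics.lean` (p74757, imported).

-- STUB `stub_kernelStuffle` LANDED: `Theorems/FurushoPentagonStuffleInKZKernelStuffle.lean` (p74955, imported).

-- STUB `stub_termTransport` LANDED: `Theorems/FurushoPentagonStuffleInKZTermTransport.lean` (p75353, imported).

/-! ## Glue lemmas -/

section Glue

variable {N : ℕ}

/-- **Finite integrand additivity over a list** (rule 1b, `|l|` moves peeling one summand at a time;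
each remainder `f − g₁ − ⋯ − gᵢ` is semialgebraic and integrable as a difference, so every intermediate
is a representation): if the `Rs i`, `i ∈ l`, live on the domain of `R` and `R.integrand = Σᵢ (Rs i).integrand`
there, then `[R] − Σᵢ [Rs i] ∈ KZ.relations`. [cite: KontsevichZagier2001, §1.2 rule (1)] -/
theorem of_sub_list_sum_mem_relations {ι : Type*} (l : List ι) :
    ∀ (R : IntegralRep N) (Rs : ι → IntegralRep N), (∀ i ∈ l, (Rs i).domain = R.domain) →
      Set.EqOn R.integrand (fun x => (l.map fun i => (Rs i).integrand x).sum) R.domain →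
      of R - (l.map fun i => of (Rs i)).sum ∈ relations := by
  induction l with
  | nil =>
    intro R Rs _ h
    simp only [List.map_nil, List.sum_nil, sub_zero]
    exact of_mem_relations_of_eqOn_zero R (fun x hx => by simpa using h hx)
  | cons a l ih =>
    intro R Rs hd h
    have hda : (Rs a).domain = R.domain := hd a (by simp)
    let R' : IntegralRep N :=
      { domain := R.domain
        integrand := fun x => R.integrand x - (Rs a).integrand x
        isSemialgebraic_domain := R.isSemialgebraic_domain
        isSemialgebraicFunOn_integrand :=
          IsSemialgebraicFunOn.sub_holds R.isSemialgebraicFunOn_integrand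
            (hda ▸ (Rs a).isSemialgebraicFunOn_integrand)
        integrableOn := R.integrableOn.sub (hda ▸ (Rs a).integrableOn) }
    have h1 : of R - of (Rs a) - of R' ∈ relations :=
      integrandAddRel_subset_relations ⟨N, R, Rs a, R', hda, rfl, fun x _ => by
        simp only [Pi.add_apply, R']
        ring, rfl⟩
    have h2 : of R' - (l.map fun i => of (Rs i)).sum ∈ relations :=
      ih R' Rs (fun i hi => (hd i (by simp [hi])).trans rfl) (fun x hx => by
        have hx' : x ∈ R.domain := hx
        have := h hx'
        simp only [List.map_cons, List.sum_cons] at this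
        show R.integrand x - (Rs a).integrand x = _
        rw [this]
        ring)
    have : of R - ((a :: l).map fun i => of (Rs i)).sum =
        (of R - of (Rs a) - of R') + (of R' - (l.map fun i => of (Rs i)).sum) := by
      simp only [List.map_cons, List.sum_cons]
      abel
    rw [this]
    exact relations.add_mem h1 h2

/-- `Σ (F i − G i) = Σ F i − Σ G i` over a list. [folklore] -/
private theorem list_sum_map_sub {ι : Type*} (l : List ι) (F G : ι → FormalRep) :
    (l.map fun i => F i - G i).sum = (l.map F).sum - (l.map G).sum := by
  induction l with
  | nil => simp
  | cons a l ih => simp only [List.map_cons, List.sum_cons, ih]; abel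

/-- A list sum of relations is a relation. [folklore] -/
private theorem list_sum_mem_relations {ι : Type*} (l : List ι) (F : ι → FormalRep)
    (h : ∀ i ∈ l, F i ∈ relations) : (l.map F).sum ∈ relations := by
  induction l with
  | nil => simp [relations.zero_mem]
  | cons a l ih =>
    rw [List.map_cons, List.sum_cons]
    exact relations.add_mem (h a (by simp)) (ih fun i hi => h i (by simp [hi]))

/-- The product domain of two cube representations is the cube. [folklore] -/
theorem prodDomain_eq_openCube {a b : ℕ} (r : IntegralRep a) (r' : IntegralRep b)
    (hr : r.domain = openCube a) (hr' : r'.domain = openCube b) :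
    IntegralRep.prodDomain r r' = openCube (a + b) := by
  ext z
  simp only [IntegralRep.mem_prodDomain, hr, hr', mem_openCube]
  constructor
  · rintro ⟨h1, h2⟩ i
    refine Fin.addCases (fun i => ?_) (fun j => ?_) i
    · exact h1 i
    · exact h2 j
  · intro h
    exact ⟨fun i => h _, fun j => h _⟩

/-- A term of the stuffle of two non-empty admissible indices is non-empty. [folklore] -/
theorem ne_nil_of_mem_stuffle {s t u : List ℕ} (hs : IsAdmissible s) (hs0 : s ≠ [])
    (hu : u ∈ stuffle s t) : u ≠ [] := by
  intro h
  have hsum := sum_of_mem_stuffle s t hu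
  rw [h, List.sum_nil] at hsum
  obtain ⟨c, s', rfl⟩ := List.exists_cons_of_ne_nil hs0
  have hc : 2 ≤ c := hs.2 (List.cons_ne_nil c s')
  simp only [List.sum_cons] at hsum
  omega

end Glue

/-! ## Composition: the stubs imply the crux -/

open Summit.KontsevichZagierPeriods.Theorems.StuffleInKZ.Negative (stuffleInKZ_iff_ne_nil defect simplexOf)

/-- **The crux from the stubs.** [cite: Hoffman1997, Thm 4.2] -/
theorem StuffleInKZ_of : StuffleInKZ := by
  classical
  rw [stuffleInKZ_iff_ne_nil]
  intro Z hZ s t hs0 ht0 hs ht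
  -- notation
  have hs1 : ∀ i ∈ s, 1 ≤ i := hs.1
  have ht1 : ∀ i ∈ t, 1 ≤ i := ht.1
  -- the charts of `s` and `t`
  have hchart := stub_cubeChart stub_chartCalculus
  obtain ⟨⟨Cs, hCsd, hCsi⟩, hCse⟩ := hchart s hs hs0
  obtain ⟨⟨Ct, hCtd, hCti⟩, hCte⟩ := hchart t ht ht0
  have hEs := hCse Cs hCsd hCsi
  have hEt := hCte Ct hCtd hCti
  -- step 2: the product
  have hprod : of ((mzvRep s hs (mzvIntegrand_isSemialgebraicFunOn_holds s)
      (mzvIntegrand_integrableOn_holds s hs)).prod (mzvRep t ht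
      (mzvIntegrand_isSemialgebraicFunOn_holds t) (mzvIntegrand_integrableOn_holds t ht))) -
      of (Cs.prod Ct) ∈ relations := Equivalent.prod hEs hEt
  -- combinatorics
  obtain ⟨hmem, -, hperm⟩ := stub_pathsCombinatorics
  have hcount : ∀ (k l : ℕ) (p : List Step), p ∈ paths k l → cx p = k ∧ cy p = l :=
    fun k l p hp => (hmem k l p).1 hp
  have henum := stub_enumeration s t
  set P := paths s.length t.length with hP
  have hu_mem : ∀ p ∈ P, merge p s t ∈ stuffle s t := fun p hp => by
    rw [henum]; exact List.mem_map.mpr ⟨p, hp, rfl⟩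
  have hu_adm : ∀ p ∈ P, IsAdmissible (merge p s t) := fun p hp =>
    isAdmissible_of_mem_stuffle hs ht (hu_mem p hp)
  have hu_ne : ∀ p ∈ P, merge p s t ≠ [] := fun p hp => ne_nil_of_mem_stuffle hs hs0 (hu_mem p hp)
  -- the cube representations of the terms (step 1 for each term)
  have hC : ∀ p ∈ P, ∃ C : IntegralRep (weight (merge p s t)),
      (C.domain = openCube (weight (merge p s t)) ∧
        Set.EqOn C.integrand (fun x => cubeKernel (merge p s t) (List.ofFn x)) C.domain) ∧
      of C - Z (merge p s t) ∈ relations := by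
    intro p hp
    obtain ⟨⟨C, hCd, hCi⟩, hCe⟩ := hchart (merge p s t) (hu_adm p hp) (hu_ne p hp)
    refine ⟨C, ⟨hCd, hCi⟩, ?_⟩
    rw [hZ _ (hu_adm p hp)]
    simpa using relations.neg_mem (hCe C hCd hCi)
  -- the transported representations `R p` on the big cube (step 5 for each term)
  have hR : ∀ p ∈ P, ∃ R : IntegralRep (weight s + weight t),
      R.domain = openCube (weight s + weight t) ∧
      Set.EqOn R.integrand (fun z => pathKernel s t p
        (List.ofFn fun i => z (Fin.castAdd (weight t) i))
        (List.ofFn fun j => z (Fin.natAdd (weight s) j))) R.domain ∧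
      of R - Z (merge p s t) ∈ relations := by
    intro p hp
    obtain ⟨C, ⟨hCd, hCi⟩, hCZ⟩ := hC p hp
    obtain ⟨-, hT⟩ := stub_termTransport s t p (hcount _ _ p hp).1 (hcount _ _ p hp).2
    obtain ⟨R, hRd, hRi, hRC⟩ := hT C hCd hCi
    refine ⟨R, hRd, hRi, ?_⟩
    have : of R - Z (merge p s t) = (of R - of C) + (of C - Z (merge p s t)) := by abel
    rw [this]
    exact relations.add_mem hRC hCZ
  let R : List Step → IntegralRep (weight s + weight t) := fun p =>
    if hp : p ∈ P then Classical.choose (hR p hp) else Cs.prod Ct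
  have hRspec : ∀ p (hp : p ∈ P), (R p).domain = openCube (weight s + weight t) ∧
      Set.EqOn (R p).integrand (fun z => pathKernel s t p
        (List.ofFn fun i => z (Fin.castAdd (weight t) i))
        (List.ofFn fun j => z (Fin.natAdd (weight s) j))) (R p).domain ∧
      of (R p) - Z (merge p s t) ∈ relations := by
    intro p hp
    simp only [R, dif_pos hp]
    exact Classical.choose_spec (hR p hp)
  -- step 3 + 4: the kernel identity and finite additivity on the big cube
  have hdom : (Cs.prod Ct).domain = openCube (weight s + weight t) := by
    rw [IntegralRep.prod_domain]
    exact prodDomain_eq_openCube Cs Ct hCsd hCtd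
  have hadd : of (Cs.prod Ct) - (P.map fun p => of (R p)).sum ∈ relations := by
    refine of_sub_list_sum_mem_relations P (Cs.prod Ct) R (fun p hp => by
      rw [(hRspec p hp).1, hdom]) (fun z hz => ?_)
    have hz' : z ∈ openCube (weight s + weight t) := hdom ▸ hz
    have hzs : (fun i => z (Fin.castAdd (weight t) i)) ∈ Cs.domain := by
      rw [IntegralRep.prod_domain, IntegralRep.mem_prodDomain] at hz; exact hz.1
    have hzt : (fun j => z (Fin.natAdd (weight s) j)) ∈ Ct.domain := by
      rw [IntegralRep.prod_domain, IntegralRep.mem_prodDomain] at hz; exact hz.2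
    rw [IntegralRep.prod_integrand_eq, IntegralRep.prodFun_apply, hCsi hzs, hCti hzt]
    have hxs : ∀ x ∈ List.ofFn (fun i => z (Fin.castAdd (weight t) i)), x ∈ Set.Ioo (0 : ℝ) 1 := by
      rw [List.forall_mem_ofFn_iff]; intro i; exact hz' _
    have hys : ∀ y ∈ List.ofFn (fun j => z (Fin.natAdd (weight s) j)), y ∈ Set.Ioo (0 : ℝ) 1 := by
      rw [List.forall_mem_ofFn_iff]; intro j; exact hz' _
    rw [stub_kernelStuffle hcount hperm s t hs1 ht1 _ _ (List.length_ofFn) (List.length_ofFn) hxs hys]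
    congr 1
    refine List.map_congr_left fun p hp => ?_
    exact ((hRspec p hp).2.1 (show z ∈ (R p).domain from (hRspec p hp).1 ▸ hz')).symm
  -- step 5 summed: Σ [R p] − Σ Z (merge p s t) ∈ relations
  have hterms : (P.map fun p => of (R p)).sum - (P.map fun p => Z (merge p s t)).sum ∈ relations := by
    rw [← list_sum_map_sub]
    exact list_sum_mem_relations P _ fun p hp => (hRspec p hp).2.2
  -- step 6: enumeration
  have hZsum : ((stuffle s t).map Z).sum = (P.map fun p => Z (merge p s t)).sum := by
    rw [henum, List.map_map]
    rfl
  -- assembly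
  show defect Z s t ∈ relations
  have hmul : Z s * Z t = of ((mzvRep s hs (mzvIntegrand_isSemialgebraicFunOn_holds s)
      (mzvIntegrand_integrableOn_holds s hs)).prod (mzvRep t ht
      (mzvIntegrand_isSemialgebraicFunOn_holds t) (mzvIntegrand_integrableOn_holds t ht))) := by
    rw [hZ s hs, hZ t ht, simplexOf, simplexOf, of_mul_of]
  have key : defect Z s t =
      (of ((mzvRep s hs (mzvIntegrand_isSemialgebraicFunOn_holds s)
        (mzvIntegrand_integrableOn_holds s hs)).prod (mzvRep t ht
        (mzvIntegrand_isSemialgebraicFunOn_holds t) (mzvIntegrand_integrableOn_holds t ht))) -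
        of (Cs.prod Ct)) +
      ((of (Cs.prod Ct) - (P.map fun p => of (R p)).sum) +
        ((P.map fun p => of (R p)).sum - (P.map fun p => Z (merge p s t)).sum)) := by
    rw [defect, hmul, hZsum]
    abel
  rw [key]
  exact relations.add_mem hprod (relations.add_mem hadd hterms)

end Summit.KontsevichZagierPeriods.FurushoPentagon.StuffleInKZ
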